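import Mathlib
import HarnessLib
import Summits.HubbardSuperconductivity.HubbardSuperconductivity.Theorems.KLProgrammeKLRegimeEngineTowerImportRowsWt

/-!
# Route `KLProgramme` — crux K3 ENGINE (stmt-HubbardSuperconductivity-20437 `KLRegimeEngineV17F2`), register item «(b)-WT4»: THE THREE WEIGHTED IMPORT BINDERS OF THE
# WEIGHTED TOWER LAW OF RECORD (`klTowerBornWtAt_le_law_of_blocks_klEng_tokX`, k3c3-p2 g17 W5, l.97–102) DISCHARGED FROM WEIGHTED PLAIN LINES, ALL BLOCKS AT ONCE
# (cell gate-hubbard-kl, seat hubbard-kl-k3c2-p3 g15, row «sector-counting import»; the weighted twin of `…TowerImportBindersPlain`, p697415)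

W5's input list of record carries, for every block `1 ≤ k ≤ Kb` (`2 ≤ d`, `d·Kb ≤ j ≤ n`, rate `j`), the rows
`W·Z^i·(klTowerMeasWtAt … d k j (2i)/klLevUnitF β M 0 i (dk−1)) ≤ ι_i·λ` (`i = 1, 2`) and `≤ ι₃·λ²` (`i = 3`).  `importRowsWt_of_wplainLines_flow_all` (p698372) gives them
per block in the shapes `ι₁ = i₁·(M/β)`, `ι₂ = i₂·(M/β)³`, `ι₃ = x₆·(M/β)⁵` from weighted plain lines; this file is the quantifier glue:

* **`importBindersWt_of_wplainLines_flow_all (d R c″)`** — `∃ CW > 0`: flow-frame binders + the four count doors, `2 ≤ d`, `1 ≤ Kb`, `d·Kb ≤ j ≤ n`, `W Z λ s₂ s₄ s₆ ≥ 0`, the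
  `klScaleWt_j`-weighted plain two-, four- and six-leg pinned lines of `𝒱_{dk}[K_n]` for every `1 ≤ k ≤ Kb` bounded by `s₂·4^{−(dk−1)}·λ`, `s₄·λ`, `s₆·λ²`, and the equational
  `i₁ i₂ x₆` of p698372 ⊢ W5's three binder families VERBATIM (parenthesised `W * Z ^ i * (… / …)`, degrees `2 * i`) with `ι_i := i·(M/β)^{2i−1}`.
Proofs only; the weighted plain lines stay hypotheses (E1); nothing asserts (b), WT4, (ℓ), any stub, K3 or superconductivity.
References: BGM 2006 §2.7 (2.71a), §2.8 (2.76)–(2.77), (2.96) [cite: BenfattoGiulianiMastropietro2006].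
-/

noncomputable section

namespace Summit.HubbardSuperconductivity.HubbardSuperconductivity.Theorems.EngineV8

set_option linter.dupNamespace false -- summit = problem name (single-conjunct summit), D-0017

open Classical
open Real Finset Literature.MathematicalPhysics.QuantumLattice Literature.Probability.LatticeModels GrassmannAlgebra
open Literature.MathematicalPhysics.QuantumLattice.FermiRG
open Summit.HubbardSuperconductivity.HubbardSuperconductivity.Theorems.KLProgrammeLegKernels
open Summit.HubbardSuperconductivity.HubbardSuperconductivity.Theorems.KLRegimeSplit
open Summit.HubbardSuperconductivity.HubbardSuperconductivity.Theorems.TorusFourierL2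
open Summit.HubbardSuperconductivity.HubbardSuperconductivity.Theorems.DispersionFlow
open Summit.HubbardSuperconductivity.HubbardSuperconductivity.Theorems.KLRegimeWick

/-- **THE THREE WEIGHTED IMPORT BINDERS OF `klTowerBornWtAt_le_law_of_blocks_klEng_tokX` FROM WEIGHTED PLAIN LINES** (see the module docstring).
[cite: BenfattoGiulianiMastropietro2006, §2.7 (2.71a), §2.8 (2.76)-(2.77), (2.96)] -/
theorem importBindersWt_of_wplainLines_flow_all (d : ℕ) (R : RenConsts) (c'' : ℝ) (hc'' : 0 ≤ c'') :
    ∃ CW : ℝ, 0 < CW ∧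
      ∀ (G : GeoConsts) (P : SplitConsts) (Q : EngConsts) (cc : ℝ), R.WF2 → 0 < cc → cc ≤ klEngC₃6 P R →
      cc ≤ klThinCountC₃ R → cc ≤ klThinCount6C₃ R → cc ≤ klThinCount2C₃ R →
      ∀ μ ∈ klWindowC, ∀ U : ℝ, 0 < U → U ≤ min (klEngU₀3 P R cc) (1 / (R.Gfr 3 + 1)) →
      U ≤ klThinCountU₀ R → U ≤ klThinCount6U₀ R → U ≤ klThinCount2U₀ R → c'' * U ≤ 1 →
      ∀ β : ℝ, klBetaMin ≤ β → β ≤ Real.exp (cc / U ^ 2) →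
      ∀ (L M : ℕ) [NeZero L] [NeZero M], klEngL₃ β U ≤ L → klEngM₃ β U L ≤ M →
      ∀ n : ℕ, 1 ≤ n → n ≤ nScales β + 1 → IsKLRegime U cc (-(n : ℤ)) → HistP klPredsV17F2 L M G P Q R β U μ 0 n →
        (∀ m', 1 ≤ m' → m' < n → FlowPieceOscAt L M c'' β U μ m') →
      2 ≤ d → ∀ Kb j : ℕ, 1 ≤ Kb → d * Kb ≤ j → j ≤ n →
      ∀ (W Z lam s₂ s₄ s₆ : ℝ), 0 ≤ W → 0 ≤ Z → 0 ≤ lam → 0 ≤ s₂ → 0 ≤ s₄ → 0 ≤ s₆ →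
        (∀ k, 1 ≤ k → k ≤ Kb → ∀ (q : Fin 2) (τ' : Fin 2 → SectorLeg 1) (y' : SpaceTimeIdx L M),
          imagTimeWeight β M ^ 1 * ∑ x' ∈ univ.filter (fun x' : Fin 2 → SpaceTimeIdx L M => x' q = y'),
            klScaleWt L M β j ((univ.image x').image (fun x : SpaceTimeIdx L M => (((((2 * (x.1 : ℕ) : ℕ)) : ZMod (2 * (2 * M)))), x.2))) *
              ‖sectorisedKernel L M β (trivialMultiplier L M) (klTowerInput L M β U μ (klFlowFrameU L M β U μ n) d k) 2 τ' x'‖ ≤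
            s₂ * ((4 : ℝ) ^ (d * k - 1))⁻¹ * lam) →
        (∀ k, 1 ≤ k → k ≤ Kb → ∀ (q : Fin 4) (τ' : Fin 4 → SectorLeg 1) (y' : SpaceTimeIdx L M),
          imagTimeWeight β M ^ 3 * ∑ x' ∈ univ.filter (fun x' : Fin 4 → SpaceTimeIdx L M => x' q = y'),
            klScaleWt L M β j ((univ.image x').image (fun x : SpaceTimeIdx L M => (((((2 * (x.1 : ℕ) : ℕ)) : ZMod (2 * (2 * M)))), x.2))) *
              ‖sectorisedKernel L M β (trivialMultiplier L M) (klTowerInput L M β U μ (klFlowFrameU L M β U μ n) d k) 4 τ' x'‖ ≤ s₄ * lam) →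
        (∀ k, 1 ≤ k → k ≤ Kb → ∀ (q : Fin 6) (τ' : Fin 6 → SectorLeg 1) (y' : SpaceTimeIdx L M),
          imagTimeWeight β M ^ 5 * ∑ x' ∈ univ.filter (fun x' : Fin 6 → SpaceTimeIdx L M => x' q = y'),
            klScaleWt L M β j ((univ.image x').image (fun x : SpaceTimeIdx L M => (((((2 * (x.1 : ℕ) : ℕ)) : ZMod (2 * (2 * M)))), x.2))) *
              ‖sectorisedKernel L M β (trivialMultiplier L M) (klTowerInput L M β U μ (klFlowFrameU L M β U μ n) d k) 6 τ' x'‖ ≤ s₆ * lam ^ 2) →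
      ∀ (i₁ i₂ x₆ : ℝ), i₁ = 2 * W * Z * klThinCount2C * CW ^ 2 * s₂ → i₂ = 16 * W * Z ^ 2 * klThinCountC * CW ^ 4 * s₄ →
        x₆ = 131072 * W * Z ^ 3 * klThinCount6C * CW ^ 6 * s₆ →
      (∀ k, 1 ≤ k → k ≤ Kb → W * Z ^ 1 *
        (klTowerMeasWtAt L M β U μ (klFlowFrameU L M β U μ n) d k j (2 * 1) / klLevUnitF β M 0 1 (d * k - 1)) ≤ (i₁ * ((M : ℝ) / β)) * lam) ∧
      (∀ k, 1 ≤ k → k ≤ Kb → W * Z ^ 2 *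
        (klTowerMeasWtAt L M β U μ (klFlowFrameU L M β U μ n) d k j (2 * 2) / klLevUnitF β M 0 2 (d * k - 1)) ≤ (i₂ * ((M : ℝ) / β) ^ 3) * lam) ∧
      (∀ k, 1 ≤ k → k ≤ Kb → W * Z ^ 3 *
        (klTowerMeasWtAt L M β U μ (klFlowFrameU L M β U μ n) d k j (2 * 3) / klLevUnitF β M 0 3 (d * k - 1)) ≤ (x₆ * ((M : ℝ) / β) ^ 5) * lam ^ 2) := by
  obtain ⟨CW, hCW, h⟩ := importRowsWt_of_wplainLines_flow_all d R c'' hc''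
  refine ⟨CW, hCW, ?_⟩
  intro G P Q cc hR2 hcc hcc6 hccT hccT6 hccT2 μ hμ U hU hUle hUT hUT6 hUT2 hcU β hβmin hβc L M _ _ hL3 hM3 n hn1 hnN hreg hhist hosc
    hd Kb j hKb hKbj hjn W Z lam s₂ s₄ s₆ hW hZ hlam hs₂ hs₄ hs₆ hS₂ hS₄ hS₆ i₁ i₂ x₆ hi₁ hi₂ hx₆
  have hrow : ∀ k, 1 ≤ k → k ≤ Kb →
      W * Z ^ 1 * klTowerMeasWtAt L M β U μ (klFlowFrameU L M β U μ n) d k j 2 / klLevUnitF β M 0 1 (d * k - 1) ≤ (i₁ * ((M : ℝ) / β)) * lam ∧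
      W * Z ^ 2 * klTowerMeasWtAt L M β U μ (klFlowFrameU L M β U μ n) d k j 4 / klLevUnitF β M 0 2 (d * k - 1) ≤ (i₂ * ((M : ℝ) / β) ^ 3) * lam ∧
      W * Z ^ 3 * klTowerMeasWtAt L M β U μ (klFlowFrameU L M β U μ n) d k j 6 / klLevUnitF β M 0 3 (d * k - 1) ≤
        (x₆ * ((M : ℝ) / β) ^ 5) * lam ^ 2 := by
    intro k hk hkK
    have hdk : d * k ≤ d * Kb := Nat.mul_le_mul_left d hkK
    have hdk2 : 2 ≤ d * k := le_trans hd (Nat.le_mul_of_pos_right d hk)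
    exact h G P Q cc hR2 hcc hcc6 hccT hccT6 hccT2 μ hμ U hU hUle hUT hUT6 hUT2 hcU β hβmin hβc L M hL3 hM3 n hn1 hnN hreg hhist hosc
      k j (by omega) (by omega) (by omega) W Z lam s₂ s₄ s₆ hW hZ hlam hs₂ hs₄ hs₆ (hS₂ k hk hkK) (hS₄ k hk hkK) (hS₆ k hk hkK) i₁ i₂ x₆ hi₁ hi₂ hx₆
  refine ⟨fun k hk hkK => ?_, fun k hk hkK => ?_, fun k hk hkK => ?_⟩
  · rw [← mul_div_assoc]; exact (hrow k hk hkK).1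
  · rw [← mul_div_assoc]; exact (hrow k hk hkK).2.1
  · rw [← mul_div_assoc]; exact (hrow k hk hkK).2.2

end Summit.HubbardSuperconductivity.HubbardSuperconductivity.Theorems.EngineV8

end
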